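import Mathlib
import Literature.Analysis.ODE.LinearComparison
import Summits.NavierStokesRegularity.NavierStokesRegularity.Theorems.SubOnsagerCeilingDyadicRangeRegion
import HarnessLib

/-!
# The ν-uniform shell barrier for the positive viscous Katz–Pavlović chain at every scale ratio
# `b ∈ [17/10, 2]` (helper file for crux stmt-NavierStokesRegularity-27057, `--supports`)

**What is proved (`chain_shellBarrier`).** Let `b ∈ [17/10, 2]`, `c₀ > 0`, `ν > 0`, and let
`Z_k : [0, s] → ℝ` (`k ≥ -1`, `Z_{-1} ≡ 0`) be an honest solution of the NS-scaled viscous chain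
`Ż_k = c₀(b^{5(k-1)/2} Z²_{k-1} − b^{5k/2} Z_k Z_{k+1}) − ν b^{2k} Z_k` on `[0, s]` from the one-shell
datum `Z_k(0) = x₀·1_{k=0}`, continuous, non-negative on the shells `k ≥ 1`, with Tao's weight
bound `(1 + b^{10k})|Z_k(t)| ≤ M`. Then for all `t ∈ [0, s]` and `k ≥ 0`

  `b^{2θk} Z_k(t)² ≤ 100 · x₀²`,  `θ = 101/200 > 1/2`,

uniformly in `ν`, `c₀`, `s` and the datum. For `b = 2` this is (a form of) Barbato–Morandin–Romito
2011, Thm. 1 (first claim of the proof) — in the tree as the rung `stub_dyadicRatioTwo` (p610572);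
the range `b ∈ [1.7, 2)` is NEW (the published region is pinned to `λ = 2`; removing that
restriction is asked for in arXiv:1506.07480, p. 3).

**Proof.** Rescale `Y_{k+1} = A b^{θk} σ_k Z_k` (`σ_0 = sign x₀`, `σ_k = 1` otherwise;
`A = δ/(|x₀| + η)`): this is the abstract chain of `DyadicRange.invariantRegion_le_one_of_tail` with
`F_{k+1} = (c₀/A) b^{2θ-5/2} L^k`, `L = b^{5/2-θ}`, `p = b^{5/2-3θ} = b^{197/200} ≥ (17/10)^{197/200}
≥ 42/25`, `p² = b^{197/100} ≤ b^{399/200} = L`, `κ_{k+1} = νb^{2k}` (ratio `b² ≤ 4`); the tail is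
quiescent by the weight bound, the datum shell keeps its sign (linear comparison), and the region
lemma gives `Y ≤ 1`, i.e. `b^{2θk}Z_k² ≤ (|x₀| + η)²/δ²` for every `η > 0`.

HONEST FRAMING: MODEL lattice ODE statement (rung under crux `ForwardTailCeilingKP` of route
SubOnsagerCeiling, TL-M2Break, one-mode chain class, large-ratio regime `ε₀ ∈ [7/10, 1]`); nothing
here bears on Navier–Stokes regularity and no crux or summit is proved.
[cite: BarbatoMorandinRomito2011, §2 Lemma 2.1, §3.2 proof of Thm. 1] [cite: Tao2016AveragedNS, §4 (4.5), (4.13)]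
-/

noncomputable section

-- the sub-problem namespace `NavierStokesRegularity.NavierStokesRegularity` is the tree's layout (D-0017)
set_option linter.dupNamespace false

namespace Summit.NavierStokesRegularity.NavierStokesRegularity.Theorems.DyadicRange

open Set Filter Topology

/-! ## Numerical facts about the scale ratio -/

/-- `(17/10)^{197/200} ≥ 42/25` (since `(42/25)^{200} ≤ (17/10)^{197}`). [folklore] -/
theorem rpow_seventeen_tenths_ge : (42 / 25 : ℝ) ≤ (17 / 10 : ℝ) ^ ((197 : ℝ) / 200) := by
  have h0 : (0 : ℝ) ≤ (17 / 10 : ℝ) ^ ((197 : ℝ) / 200) := by positivity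
  have h2 : ((17 / 10 : ℝ) ^ ((197 : ℝ) / 200)) ^ (200 : ℕ) = (17 / 10 : ℝ) ^ (197 : ℕ) := by
    rw [← Real.rpow_natCast, ← Real.rpow_mul (by norm_num)]
    norm_num
  by_contra h
  push Not at h
  have h3 : ((17 / 10 : ℝ) ^ ((197 : ℝ) / 200)) ^ (200 : ℕ) < (42 / 25 : ℝ) ^ (200 : ℕ) :=
    pow_lt_pow_left₀ h h0 (by norm_num)
  rw [h2] at h3
  norm_num at h3

/-- For `b ≥ 17/10`: `p = b^{197/200} ≥ 42/25`. [folklore] -/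
theorem p_ge {b : ℝ} (hb : 17 / 10 ≤ b) : (42 / 25 : ℝ) ≤ b ^ ((197 : ℝ) / 200) :=
  rpow_seventeen_tenths_ge.trans (Real.rpow_le_rpow (by norm_num) hb (by norm_num))

/-! ## Auxiliary lemmas (separate declarations: each has its own heartbeat budget) -/

/-- Sign preservation for the datum shell: a solution of the scalar linear equation
`ġ = -(c₀ Z₁ + ν) g` on `[0, s)` with `g(0) ≥ 0` stays `≥ 0` on `[0, s]` (linear comparison).
[folklore] -/
theorem datum_sign_nonneg {c₀ ν s : ℝ} {g Z₁ : ℝ → ℝ} (hg : ContinuousOn g (Icc 0 s))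
    (hZ₁ : ContinuousOn Z₁ (Icc 0 s))
    (hode : ∀ r ∈ Ico 0 s, HasDerivWithinAt g (0 + (-(c₀ * Z₁ r + ν)) * g r) (Ici r) r)
    (h0 : 0 ≤ g 0) : ∀ τ ∈ Icc 0 s, 0 ≤ g τ := by
  intro τ hτ
  have hcβ : ContinuousOn (fun r => -(c₀ * Z₁ r + ν)) (Icc 0 s) :=
    ((continuousOn_const.mul hZ₁).add continuousOn_const).neg
  have key := Literature.Analysis.ODE.linearComparison_le (A := fun _ => (0 : ℝ)) hg hode
    continuousOn_const hcβ (fun r _ => le_rfl) hτ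
  simp only [zero_mul, intervalIntegral.integral_zero, add_zero] at key
  exact le_trans (mul_nonneg (Real.exp_pos _).le h0) key

/-- A geometric tail drops below `1/10`: for `0 ≤ q < 1` and `C ≥ 0` there is `K` with
`C q^k ≤ 1/10` for all `k ≥ K`. [folklore] -/
theorem geometric_tail_small {q C : ℝ} (hq0 : 0 ≤ q) (hq1 : q < 1) (hC : 0 ≤ C) :
    ∃ K : ℕ, ∀ k, K ≤ k → C * q ^ k ≤ 1 / 10 := by
  obtain ⟨K, hK⟩ := exists_pow_lt_of_lt_one (show 0 < (1 / 10) / (C + 1) by positivity) hq1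
  refine ⟨K, fun k hk => ?_⟩
  have h2 : q ^ k ≤ q ^ K := pow_le_pow_of_le_one hq0 hq1.le hk
  have h3 : C * q ^ k ≤ C * ((1 / 10) / (C + 1)) := mul_le_mul_of_nonneg_left (h2.trans hK.le) hC
  have h4 : C * ((1 / 10) / (C + 1)) ≤ 1 / 10 := by
    rw [mul_div_assoc', div_le_iff₀ (by positivity)]
    nlinarith
  linarith

/-- The rescaling identity at the datum shell (`k = 0`: no feed, `Y₀ = 0`). Pure algebra.
[cite: BarbatoMorandinRomito2011, §2 (e:Yeq)] -/
theorem rescale_identity_zero (A B₁ B₅ c₀ ν σ z₀ z₁ : ℝ) (hA : A ≠ 0) (hB₁ : B₁ ≠ 0)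
    (hB₅ : B₅ ≠ 0) :
    A * B₁ ^ 0 * σ * (c₀ * (B₅ ^ 0 / B₅ * (0 : ℝ) ^ 2 - B₅ ^ 0 * (z₀ * z₁)) - ν * 1 * z₀) =
      -ν * (A * B₁ ^ 0 * (σ * z₀)) +
        c₀ / A * (B₁ ^ 2 / B₅) * (B₅ / B₁) ^ 0 *
          ((0 : ℝ) ^ 2 - B₅ / B₁ ^ 3 * (A * B₁ ^ 0 * (σ * z₀)) * (A * B₁ ^ (0 + 1) * z₁)) := by
  simp only [pow_zero, zero_add, pow_one]
  field_simp
  ring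

/-- The rescaling identity at a shell `k = j+1 ≥ 1`. Pure algebra (`sg² = 1` is the sign of the
datum shell when `j = 0`). [cite: BarbatoMorandinRomito2011, §2 (e:Yeq)] -/
theorem rescale_identity_succ (A B₁ B₅ c₀ ν b2 sg zj zk zk1 : ℝ) (j : ℕ) (hA : A ≠ 0)
    (hB₁ : B₁ ≠ 0) (hB₅ : B₅ ≠ 0) (hsg : sg ^ 2 = 1) :
    A * B₁ ^ (j + 1) * 1 *
        (c₀ * (B₅ ^ (j + 1) / B₅ * zj ^ 2 - B₅ ^ (j + 1) * (zk * zk1)) - ν * b2 ^ (j + 1) * zk) =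
      -(ν * b2 ^ (j + 1)) * (A * B₁ ^ (j + 1) * (1 * zk)) +
        c₀ / A * (B₁ ^ 2 / B₅) * (B₅ / B₁) ^ (j + 1) *
          ((A * B₁ ^ j * (sg * zj)) ^ 2 -
            B₅ / B₁ ^ 3 * (A * B₁ ^ (j + 1) * (1 * zk)) * (A * B₁ ^ (j + 1 + 1) * zk1)) := by
  have esq : (A * B₁ ^ j * (sg * zj)) ^ 2 = A ^ 2 * (B₁ ^ j) ^ 2 * zj ^ 2 := by
    calc (A * B₁ ^ j * (sg * zj)) ^ 2 = A ^ 2 * (B₁ ^ j) ^ 2 * zj ^ 2 * sg ^ 2 := by ring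
      _ = A ^ 2 * (B₁ ^ j) ^ 2 * zj ^ 2 := by rw [hsg, mul_one]
  rw [esq, div_pow]
  field_simp
  ring

/-- The two rescaling constants at ratio `b ∈ [17/10, 2]`: `p = b^{5/2}/b^{3θ} ≥ 42/25` and
`p² ≤ L = b^{5/2}/b^{θ}` (`θ = 101/200`). [folklore] -/
theorem ratio_consts {b : ℝ} (hb : 17 / 10 ≤ b) :
    42 / 25 ≤ b ^ ((5 : ℝ) / 2) / (b ^ ((101 : ℝ) / 200)) ^ 3 ∧
      (b ^ ((5 : ℝ) / 2) / (b ^ ((101 : ℝ) / 200)) ^ 3) ^ 2 ≤ b ^ ((5 : ℝ) / 2) / b ^ ((101 : ℝ) / 200) := by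
  have hb0 : 0 < b := by linarith
  have hb1 : 1 ≤ b := by linarith
  have hp_eq : b ^ ((5 : ℝ) / 2) / (b ^ ((101 : ℝ) / 200)) ^ 3 = b ^ ((197 : ℝ) / 200) := by
    rw [← Real.rpow_natCast, ← Real.rpow_mul hb0.le, ← Real.rpow_sub hb0]
    norm_num
  have hL_eq : b ^ ((5 : ℝ) / 2) / b ^ ((101 : ℝ) / 200) = b ^ ((399 : ℝ) / 200) := by
    rw [← Real.rpow_sub hb0]; norm_num
  refine ⟨hp_eq ▸ p_ge hb, ?_⟩
  rw [hp_eq, hL_eq, ← Real.rpow_natCast, ← Real.rpow_mul hb0.le]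
  exact Real.rpow_le_rpow_of_exponent_le hb1 (by norm_num)

/-- The viscous rates `κₙ = ν b2ⁿ/b2` (`1 ≤ b2 ≤ 4`, `ν > 0`): positive, non-decreasing, ratio `≤ 4`,
and `κ_{k+1} = ν b2ᵏ`. [folklore] -/
theorem kappa_facts {ν b2 : ℝ} (hν : 0 < ν) (hb20 : 0 < b2) (hb21 : 1 ≤ b2) (hb24 : b2 ≤ 4) :
    (∀ n : ℕ, 0 < ν * b2 ^ n / b2) ∧ (∀ n : ℕ, ν * b2 ^ n / b2 ≤ ν * b2 ^ (n + 1) / b2) ∧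
      (∀ n : ℕ, ν * b2 ^ (n + 1) / b2 ≤ 4 * (ν * b2 ^ n / b2)) ∧
        (∀ k : ℕ, ν * b2 ^ (k + 1) / b2 = ν * b2 ^ k) := by
  refine ⟨fun n => by positivity, fun n => ?_, fun n => ?_, fun k => ?_⟩
  · apply div_le_div_of_nonneg_right _ hb20.le
    rw [pow_succ]
    have h1 : 0 ≤ ν * b2 ^ n := by positivity
    nlinarith
  · rw [pow_succ, show 4 * (ν * b2 ^ n / b2) = ν * (b2 ^ n * 4) / b2 by ring]
    apply div_le_div_of_nonneg_right _ hb20.le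
    have h1 : 0 ≤ ν * b2 ^ n := by positivity
    nlinarith
  · rw [pow_succ]; field_simp

/-- The production rates `Fₙ = G Lⁿ/L` (`G, L > 0`): positive, `F_{n+1} = L Fₙ`, `F_{k+1} = G Lᵏ`.
[folklore] -/
theorem prod_facts {G L : ℝ} (hG : 0 < G) (hL : 0 < L) :
    (∀ n : ℕ, 0 < G * L ^ n / L) ∧ (∀ n : ℕ, G * L ^ (n + 1) / L = L * (G * L ^ n / L)) ∧
      (∀ k : ℕ, G * L ^ (k + 1) / L = G * L ^ k) := by
  refine ⟨fun n => by positivity, fun n => ?_, fun k => ?_⟩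
  · rw [pow_succ]; field_simp
  · rw [pow_succ]; field_simp

/-- The final rescaling step: from `0 ≤ y ≤ 1`, `y = A Bᵏ (s z)`, `s² = 1`, `A = (1/10)/(x + η)`
one gets `B^{2k} z² ≤ 100 (x + η)²`. [folklore] -/
theorem unscale_bound {A B s z x η y : ℝ} {k : ℕ} (hxη : 0 < x + η) (hA : A = 1 / 10 / (x + η))
    (hy : y = A * B ^ k * (s * z)) (hs : s ^ 2 = 1) (h0 : 0 ≤ y) (h1 : y ≤ 1) :
    B ^ (2 * k) * z ^ 2 ≤ 100 * (x + η) ^ 2 := by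
  have hA0 : 0 < A := by rw [hA]; positivity
  have hsq : y ^ 2 ≤ 1 := pow_le_one₀ h0 h1
  have hexp : y ^ 2 = A ^ 2 * ((B ^ k) ^ 2 * z ^ 2) := by
    rw [hy]
    calc (A * B ^ k * (s * z)) ^ 2 = A ^ 2 * ((B ^ k) ^ 2 * z ^ 2) * s ^ 2 := by ring
      _ = A ^ 2 * ((B ^ k) ^ 2 * z ^ 2) := by rw [hs, mul_one]
  rw [hexp] at hsq
  have hA2 : 0 < A ^ 2 := by positivity
  have hmain : (B ^ k) ^ 2 * z ^ 2 ≤ 1 / A ^ 2 := by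
    rw [le_div_iff₀ hA2]; linarith
  have hinv : 1 / A ^ 2 = 100 * (x + η) ^ 2 := by
    rw [hA]; field_simp; ring
  rw [show B ^ (2 * k) = (B ^ k) ^ 2 by rw [mul_comm, pow_mul]]
  linarith [hmain, hinv.le, hinv.ge]

/-! ## The chain barrier -/

/-- **The ν-uniform shell barrier for the positive viscous Katz–Pavlović chain at scale ratio
`b ∈ [17/10, 2]`** (see the module docstring): `b^{2θk}Z_k(t)² ≤ 100·x₀²`, `θ = 101/200`, along
every honest solution on `[0, s]` from the one-shell datum `x₀`, for every viscosity `ν > 0` and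
coupling `c₀ > 0`. [cite: BarbatoMorandinRomito2011, §2 Lemma 2.1 and §3.2] -/
theorem chain_shellBarrier {b c₀ ν s x₀ : ℝ} (hb : 17 / 10 ≤ b) (hb2 : b ≤ 2) (hc₀ : 0 < c₀)
    (hν : 0 < ν) (hs : 0 < s) {Z : ℤ → ℝ → ℝ}
    (hdat : ∀ k : ℤ, Z k 0 = if k = 0 then x₀ else 0)
    (hvan : ∀ t, Z (-1) t = 0)
    (hbdd : ∃ M : ℝ, ∀ (t : ℝ) (k : ℕ), (1 + b ^ ((10 : ℝ) * k)) * |Z k t| ≤ M)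
    (hcont : ∀ k : ℕ, ContinuousOn (Z k) (Icc 0 s))
    (hode : ∀ k : ℕ, ∀ t ∈ Icc 0 s, HasDerivWithinAt (Z k)
      (c₀ * (b ^ ((5 : ℝ) * ((k : ℝ) - 1) / 2) * Z ((k : ℤ) - 1) t ^ 2 -
          b ^ ((5 : ℝ) * (k : ℝ) / 2) * (Z k t * Z ((k : ℤ) + 1) t)) -
        ν * b ^ ((2 : ℝ) * (k : ℝ)) * Z k t) (Icc 0 s) t)
    (hnn : ∀ t ∈ Icc 0 s, ∀ k : ℕ, 1 ≤ k → 0 ≤ Z k t) :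
    ∀ t ∈ Icc 0 s, ∀ k : ℕ, (b ^ ((101 : ℝ) / 200)) ^ (2 * k) * Z k t ^ 2 ≤ 100 * x₀ ^ 2 := by
  intro t ht k
  have hb0 : 0 < b := by linarith
  have hb1 : 1 ≤ b := by linarith
  -- the constants
  set B₁ : ℝ := b ^ ((101 : ℝ) / 200) with hB₁
  set B₅ : ℝ := b ^ ((5 : ℝ) / 2) with hB₅
  have hB₁0 : 0 < B₁ := Real.rpow_pos_of_pos hb0 _
  have hB₅0 : 0 < B₅ := Real.rpow_pos_of_pos hb0 _
  set L : ℝ := B₅ / B₁ with hL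
  set p : ℝ := B₅ / B₁ ^ 3 with hp
  have hL0 : 0 < L := div_pos hB₅0 hB₁0
  have hp0 : 0 < p := div_pos hB₅0 (pow_pos hB₁0 3)
  -- `p = b^{197/200} ≥ 42/25`, `p² ≤ L`
  obtain ⟨hp42, hpL⟩ : 42 / 25 ≤ p ∧ p ^ 2 ≤ L := ratio_consts hb
  set c : ℝ := p⁻¹ with hc
  have hpc : p * c = 1 := mul_inv_cancel₀ hp0.ne'
  -- powers of `b` along the shells
  have hΛ : ∀ k : ℕ, b ^ ((5 : ℝ) * (k : ℝ) / 2) = B₅ ^ k := by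
    intro k
    rw [hB₅, ← Real.rpow_mul_natCast hb0.le]; congr 1; ring
  have hΛ' : ∀ k : ℕ, b ^ ((5 : ℝ) * ((k : ℝ) - 1) / 2) = B₅ ^ k / B₅ := by
    intro k
    rw [show (5 : ℝ) * ((k : ℝ) - 1) / 2 = (5 : ℝ) * (k : ℝ) / 2 - 5 / 2 by ring, Real.rpow_sub hb0,
      hΛ k]
  have h2k : ∀ k : ℕ, b ^ ((2 : ℝ) * (k : ℝ)) = (b ^ 2) ^ k := by
    intro k
    rw [Real.rpow_mul_natCast hb0.le, Real.rpow_two]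
  -- the sign of the datum shell
  set σ : ℝ := if 0 ≤ x₀ then 1 else -1 with hσ
  have hσ2 : σ ^ 2 = 1 := by rw [hσ]; split_ifs <;> norm_num
  have hσa : σ * x₀ = |x₀| := by
    rw [hσ]; split_ifs with h
    · rw [abs_of_nonneg h, one_mul]
    · rw [abs_of_neg (not_le.1 h)]; ring
  -- the datum shell keeps its sign on `[0, s]`: `g = σ Z₀` solves `ġ = -(c₀ Z₁ + ν) g`
  have hg_nonneg : ∀ τ ∈ Icc 0 s, 0 ≤ σ * Z 0 τ := by
    have hode0 : ∀ r ∈ Ico 0 s, HasDerivWithinAt (fun r => σ * Z 0 r)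
        (0 + (-(c₀ * Z 1 r + ν)) * (σ * Z 0 r)) (Ici r) r := by
      intro r hr
      have h := hode 0 r (Ico_subset_Icc_self hr)
      have e1 : ((0 : ℕ) : ℤ) - 1 = -1 := by norm_num
      have e2 : ((0 : ℕ) : ℤ) + 1 = 1 := by norm_num
      rw [e1, e2, hvan r] at h
      have h' := (h.mono_of_mem_nhdsWithin (Icc_mem_nhdsGE_of_mem hr)).const_mul σ
      refine h'.congr_deriv ?_
      have e3 : b ^ ((5 : ℝ) * ((0 : ℕ) : ℝ) / 2) = 1 := by simp
      have e4 : b ^ ((2 : ℝ) * ((0 : ℕ) : ℝ)) = 1 := by simp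
      rw [e3, e4]
      ring
    have hcg : ContinuousOn (fun r => σ * Z 0 r) (Icc 0 s) := continuousOn_const.mul (hcont 0)
    have h00 : 0 ≤ σ * Z 0 0 := by rw [hdat 0, if_pos rfl, hσa]; exact abs_nonneg _
    exact datum_sign_nonneg hcg (hcont 1) hode0 h00
  -- the weight bound
  obtain ⟨M, hM⟩ := hbdd
  have hM0 : 0 ≤ M := le_trans (mul_nonneg (by positivity) (abs_nonneg _)) (hM 0 0)
  -- the bound for every `η > 0`
  suffices main : ∀ η : ℝ, 0 < η → B₁ ^ (2 * k) * Z k t ^ 2 ≤ 100 * (|x₀| + η) ^ 2 by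
    have hlim : Tendsto (fun η : ℝ => 100 * (|x₀| + η) ^ 2) (𝓝[>] 0) (𝓝 (100 * (|x₀| + 0) ^ 2)) :=
      ((tendsto_nhdsWithin_of_tendsto_nhds (f := fun η : ℝ => 100 * (|x₀| + η) ^ 2)
        (Continuous.tendsto (by continuity) 0)))
    rw [add_zero, sq_abs] at hlim
    exact ge_of_tendsto hlim (eventually_nhdsWithin_of_forall fun η hη => main η hη)
  intro η hη
  have hxη : 0 < |x₀| + η := by positivity
  set A : ℝ := 1 / 10 / (|x₀| + η) with hA
  have hA0 : 0 < A := by positivity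
  -- the rescaled chain
  set sg : ℕ → ℝ := fun k => if k = 0 then σ else 1 with hsg
  have hsg2 : ∀ k, sg k ^ 2 = 1 := by intro k; rw [hsg]; dsimp only; split_ifs; exact hσ2; norm_num
  set Y : ℕ → ℝ → ℝ := fun n τ =>
    if n = 0 then 0 else A * B₁ ^ (n - 1) * (sg (n - 1) * Z ((n - 1 : ℕ) : ℤ) τ) with hY
  have hY0 : ∀ τ, Y 0 τ = 0 := fun τ => by simp [hY]
  have hYs : ∀ (k : ℕ) (τ : ℝ), Y (k + 1) τ = A * B₁ ^ k * (sg k * Z k τ) := by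
    intro k τ; simp [hY]
  have hY1 : ∀ τ, Y 1 τ = A * (σ * Z 0 τ) := fun τ => by
    rw [show (1 : ℕ) = 0 + 1 from rfl, hYs]; simp [hsg]
  have hY2 : ∀ (j : ℕ) (τ : ℝ), Y (j + 2) τ = A * B₁ ^ (j + 1) * Z ((j + 1 : ℕ) : ℤ) τ := by
    intro j τ; rw [show j + 2 = (j + 1) + 1 from rfl, hYs]; simp [hsg]
  set b2 : ℝ := b ^ 2 with hb2def
  have hb20 : 0 < b2 := by rw [hb2def]; positivity
  have hb21 : 1 ≤ b2 := by rw [hb2def]; exact one_le_pow₀ hb1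
  have hb24 : b2 ≤ 4 := by rw [hb2def]; nlinarith
  set G : ℝ := c₀ / A * (B₁ ^ 2 / B₅) with hG
  have hG0 : 0 < G := by rw [hG]; positivity
  set κ : ℕ → ℝ := fun n => ν * b2 ^ n / b2 with hκ
  set F : ℕ → ℝ := fun n => G * L ^ n / L with hF
  obtain ⟨hκpos, hκmono, hκ4, hκs0⟩ :
      (∀ n, 0 < κ n) ∧ (∀ n, κ n ≤ κ (n + 1)) ∧ (∀ n, κ (n + 1) ≤ 4 * κ n) ∧
        (∀ k : ℕ, κ (k + 1) = ν * b2 ^ k) := kappa_facts hν hb20 hb21 hb24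
  obtain ⟨hFpos, hFL, hFs0⟩ :
      (∀ n, 0 < F n) ∧ (∀ n, F (n + 1) = L * F n) ∧ (∀ k : ℕ, F (k + 1) = G * L ^ k) :=
    prod_facts hG0 hL0
  have hκs : ∀ k : ℕ, κ (k + 1) = ν * b2 ^ k := hκs0
  have hFs : ∀ k : ℕ, F (k + 1) = G * L ^ k := hFs0
  -- continuity, positivity, datum
  have hYcont : ∀ n, ContinuousOn (Y n) (Icc 0 s) := by
    intro n
    rcases n with _ | k
    · have : Y 0 = fun _ => 0 := funext hY0
      rw [this]; exact continuousOn_const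
    · have : Y (k + 1) = fun τ => A * B₁ ^ k * (sg k * Z k τ) := funext (hYs k)
      rw [this]
      exact continuousOn_const.mul (continuousOn_const.mul (hcont k))
  have hYpos : ∀ n, ∀ τ ∈ Icc 0 s, 0 ≤ Y n τ := by
    intro n τ hτ
    rcases n with _ | k
    · rw [hY0]
    rcases k with _ | j
    · rw [hY1]; exact mul_nonneg hA0.le (hg_nonneg τ hτ)
    · rw [hY2]; exact mul_nonneg (by positivity) (hnn τ hτ (j + 1) (by omega))
  have hYinit : ∀ n, Y n 0 ≤ 1 / 10 := by
    intro n
    rcases n with _ | k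
    · rw [hY0]; norm_num
    rcases k with _ | j
    · have hAx : A * |x₀| ≤ 1 / 10 := by
        rw [hA, div_mul_eq_mul_div, div_le_iff₀ hxη]
        linarith [abs_nonneg x₀]
      rw [hY1, hdat 0, if_pos rfl, hσa]; exact hAx
    · have hne : (((j + 1 : ℕ) : ℤ)) ≠ 0 := Int.natCast_ne_zero.mpr (Nat.succ_ne_zero j)
      rw [hY2, hdat, if_neg hne, mul_zero]; norm_num
  -- the quiescent tail (Tao's weight bound (4.5))
  have hbt : 0 < b ^ (10 : ℝ) := Real.rpow_pos_of_pos hb0 _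
  set q : ℝ := B₁ / b ^ (10 : ℝ) with hq
  have hq0 : 0 ≤ q := by rw [hq]; positivity
  have hq1 : q < 1 := by
    rw [hq, div_lt_one hbt, hB₁]
    exact Real.rpow_lt_rpow_of_exponent_lt (by linarith) (by norm_num)
  have hZle : ∀ (k : ℕ) (τ : ℝ), (b ^ (10 : ℝ)) ^ k * |Z k τ| ≤ M := by
    intro k τ
    have h := hM τ k
    rw [Real.rpow_mul_natCast hb0.le] at h
    have h0 : 0 ≤ |Z k τ| := abs_nonneg _
    have h1 : (1 + (b ^ (10 : ℝ)) ^ k) * |Z k τ| = |Z k τ| + (b ^ (10 : ℝ)) ^ k * |Z k τ| := by ring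
    linarith
  have hYle' : ∀ (k : ℕ) (τ : ℝ), Y (k + 1) τ ≤ A * M * q ^ k := by
    intro k τ
    rw [hYs]
    have hs : |sg k| = 1 := by
      rw [hsg]; dsimp only; split_ifs
      · rw [hσ]; split_ifs <;> norm_num
      · norm_num
    have h1 : sg k * Z k τ ≤ |Z k τ| := by
      have := le_abs_self (sg k * Z k τ)
      rwa [abs_mul, hs, one_mul] at this
    have h2 : B₁ ^ k * |Z k τ| = q ^ k * ((b ^ (10 : ℝ)) ^ k * |Z k τ|) := by
      rw [hq, div_pow]; field_simp
    have h3 : q ^ k * ((b ^ (10 : ℝ)) ^ k * |Z k τ|) ≤ q ^ k * M :=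
      mul_le_mul_of_nonneg_left (hZle k τ) (pow_nonneg hq0 k)
    calc A * B₁ ^ k * (sg k * Z k τ) ≤ A * B₁ ^ k * |Z k τ| :=
          mul_le_mul_of_nonneg_left h1 (by positivity)
      _ = A * (B₁ ^ k * |Z k τ|) := by ring
      _ = A * (q ^ k * ((b ^ (10 : ℝ)) ^ k * |Z k τ|)) := by rw [h2]
      _ ≤ A * (q ^ k * M) := mul_le_mul_of_nonneg_left h3 hA0.le
      _ = A * M * q ^ k := by ring
  obtain ⟨K, hK⟩ := geometric_tail_small hq0 hq1 (show 0 ≤ A * M by positivity)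
  have hYtail : ∀ n, K + 1 ≤ n → ∀ τ ∈ Icc 0 s, Y n τ ≤ 1 / 10 := by
    intro n hn τ _
    obtain ⟨k, rfl⟩ : ∃ k, n = k + 1 := ⟨n - 1, by omega⟩
    exact (hYle' k τ).trans (hK k (by omega))
  -- the equations of motion of the rescaled chain
  have hYderiv : ∀ n, 1 ≤ n → ∀ τ ∈ Ico 0 s, HasDerivWithinAt (Y n)
      (-κ n * Y n τ + F n * (Y (n - 1) τ ^ 2 - p * Y n τ * Y (n + 1) τ)) (Ici τ) τ := by
    intro n hn τ hτ
    obtain ⟨k, rfl⟩ : ∃ k, n = k + 1 := ⟨n - 1, by omega⟩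
    have h := hode k τ (Ico_subset_Icc_self hτ)
    rw [hΛ' k, hΛ k, h2k k] at h
    have h' := (h.mono_of_mem_nhdsWithin (Icc_mem_nhdsGE_of_mem hτ)).const_mul (A * B₁ ^ k * sg k)
    have hfun : Y (k + 1) = fun r => A * B₁ ^ k * sg k * Z k r := by
      funext r; rw [hYs]; ring
    rw [hfun]
    refine h'.congr_deriv ?_
    simp only [Nat.add_sub_cancel]
    rw [hκs k, hFs k, show k + 1 + 1 = k + 2 from rfl, hY2 k]
    have ek : ((k : ℕ) : ℤ) + 1 = (((k + 1 : ℕ)) : ℤ) := by push_cast; ring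
    rw [ek]
    rcases k with _ | j
    · -- the datum shell: no feed (`Z_{-1} = 0`, `Y_0 = 0`)
      have e1 : ((0 : ℕ) : ℤ) - 1 = -1 := by norm_num
      rw [e1, hvan τ, hY0, hG, hL, hp]
      linear_combination rescale_identity_zero A B₁ B₅ c₀ ν (sg 0) (Z 0 τ) (Z ((0 + 1 : ℕ) : ℤ) τ)
        hA0.ne' hB₁0.ne' hB₅0.ne'
    · have e1 : (((j + 1 : ℕ)) : ℤ) - 1 = ((j : ℕ) : ℤ) := by push_cast; ring
      have es1 : sg (j + 1) = 1 := by simp [hsg]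
      rw [e1, hYs j, es1, hG, hL, hp]
      linear_combination rescale_identity_succ A B₁ B₅ c₀ ν b2 (sg j) (Z j τ)
        (Z ((j + 1 : ℕ) : ℤ) τ) (Z ((j + 1 + 1 : ℕ) : ℤ) τ) j hA0.ne' hB₁0.ne' hB₅0.ne' (hsg2 j)
  -- the region lemma: `Y ≤ 1`
  have hYle : ∀ n, ∀ τ ∈ Icc 0 s, Y n τ ≤ 1 :=
    invariantRegion_le_one_of_tail hs hκpos hκmono hκ4 hFpos hFL hp42 hpL hpc hY0 hYcont hYderiv
      hYpos hYinit hYtail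
  -- conclusion at the shell `k`
  exact unscale_bound hxη hA (hYs k t) (hsg2 k) (hYpos (k + 1) t ht) (hYle (k + 1) t ht)

end Summit.NavierStokesRegularity.NavierStokesRegularity.Theorems.DyadicRange

end
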